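import Literature.AlgebraicGeometry.HodgeTheory.RealMultiplicationPowersHodgeClasses
import Literature.AlgebraicGeometry.Motives.HodgeThetaSubalgebraUnitary
import Literature.RepresentationTheory.ClassicalInvariants.MixedTensorLieInvariantsGL
import Literature.AlgebraicGeometry.Milne1999.SpecialLefschetzGroupInvariantsGLMultiplicity
import HarnessLib

/-!
# Hodge classes on abelian varieties with slots over `A` are generated by divisor classes when `H¹(A)` carries an imaginary quadratic structure of multiplicities `(m, 1)`, `m ≥ 2` — the Lie step `𝔲_K(V, ψ)_ℂ ≅ 𝔤𝔩(W)`, the unipotent bridge and the tensor FFT for `GL(W)` (Ribet 1983, Thm. 3 with Thm. 0; Gordon 6.3.3; Milne 1999 Prop. 3.6 (c))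

Family `hodge`, layer `Literature/AlgebraicGeometry/HodgeTheory`. Research context: cell `pub-hodge-ring2`
(HONEST FRAMING: research route conditional on HC_CM; not a corollary; Q11.4-sentence-2 already refuted in
dim ≥ 3), Literature lane, programme R9 «Ribet type `(n−1, 1)`», the abstract-data half of the geometric
step. UNCONDITIONAL; no named fact, no `sorry` (two plumbing definitions `blockLiftGen`, `placeRefineGen`).
The geometric discharge of the data from an abelian variety `A` with `End⁰(A) = K` imaginary quadratic
acting with multiplicities `(dim A − 1, 1)` is the sequel `HodgeTheory/RibetTypeOnePowersHodgeClasses`.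

THE PRINTED THEOREM (Ribet 1983 Thm. 3 with Thm. 0, through Gordon's survey Thm. 6.3 (3) [corpus:
arXiv:alg-geom/9709030 p. 18]: "`End⁰(A)` is an imaginary quadratic field `K`, and the multiplicities `n'`
and `n''` … are relatively prime. Then `Hg(A) = Lf(A)` and thus `Hdg(Aⁿ) = Div(Aⁿ)` for `n ≥ 1`"; proof
sketch pp. 18–19: `W ⊗ ℂ = W' ⊕ W''`, `MT(A, ℂ) → GL(W')` surjective, then "extend scalars to `ℂ`, so that
the unitary group … becomes a general linear group; we omit the invariant theory arguments").

DATA (all on the `ℚ`-Hodge structure `H = H¹(A(ℂ); ℚ)` of the tree's Betti universe, `V = H¹(A(ℂ); ℚ)`):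
a polarization `ψ`; `φ ∈ End_Hdg(V)` with `φ² = -d`, `d > 0`, `End_Hdg(V) = ℚ + ℚφ`; `μ² = -d`;
`W = ker(φ_ℂ - μ)`, `W' = ker(φ_ℂ + μ)`, `dim(W ∩ V^{0,1}) = 1`, `dim(W ∩ V^{1,0}) ≥ 2`; and an abelian variety
`B` with slots `g` over `A` (`AVSlots`: `H¹(B) = ⊕_j g_j^* H¹(A)`, e.g. `B = A^{N+1}`).

MAIN RESULTS.
* §1 `blockLiftGen`, `placeRefineGen` and their word-model lemmas — the tree's `blockLift`/`placeRefine`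
  (`RealMultiplicationPowersHodgeClasses` §1) with the inner index `Fin 2` generalised to `Fin k`.
* §2 `HodgeStructure.UnitaryTheta.exists_adaptedDualBasis` — a basis `(e_ℓ, f_ℓ)_{ℓ}` of `V_ℂ` with `e_ℓ ∈ W`,
  `f_ℓ ∈ W'` of pure Hodge types (`e_ℓ ∈ V^{1,0} ⟺ f_ℓ ∈ V^{0,1}`) and `ψ_ℂ(e_i, f_j) = δ_{ij}` (`W'` is the
  `ψ_ℂ`-dual of `W`; the pieces `W ∩ V^{1,0}`, `W' ∩ V^{0,1}` and `W ∩ V^{0,1}`, `W' ∩ V^{1,0}` are in perfect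
  duality by the second Hodge–Riemann relation: `UnitaryTheta.pairing_bijective`).
* §3 `AVSlots.exists_unitaryInvariant_coeff` — THE INVARIANCE THEOREM: every rational `(p,p)`-class on `B` is
  `∑_w a(w)·(g e,f)_w` for a coefficient function `a` on words in the letters `((j, t), ℓ)` (slot, type
  vector/covector, index) whose slices `a(U, −)` along every slot-and-type word `U` are killed by the typed
  differential of EVERY `X ∈ 𝔤𝔩(W)` (`X` at vector positions, `-Xᵀ` at covector positions) — THEOREM L′ of
  `HodgeThetaSubalgebraUnitary` transported to the adapted letters.
* §4 `AVSlots.unitaryHodgeClasses_divisorial`, `AVSlots.isDivisorGenerated_of_unitaryData` — THE ASSEMBLY: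
  Lie invariance ⟹ invariance under all `g ∈ GL(W)` (`ClassicalInvariants.wordRepAt_mixedFamily_eq_self_of_forall_wordDerAt_eq_zero`,
  Goodman–Wallach Thm. 2.2.2: unipotent generation) ⟹ each slice is a combination of complete contractions
  (tensor FFT for `GL`, Goodman–Wallach Thm. 5.3.1) ⟹ evaluates to `±` products of the crossed classes
  `∑_ℓ g_j^* e_ℓ ⌣ g_{j'}^* f_ℓ` (Milne 1999 Prop. 3.6 (c), Remark 3.7: `sum_contractionTensor_smul_eq`,
  `sum_cupPowOne_glPairWord_mem`), which are divisor classes by the hypothesis `hcross` (discharged in the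
  sequel from `θ = ∑_ℓ e_ℓ ⌣ f_ℓ = ½·Casimir(ψ)` and `Milne1999.sum_cross_mem_span_rational_oneOne_of_eigen`).

## References

* [Ribet1983] K. A. Ribet, *Hodge classes on certain types of abelian varieties*, Amer. J. Math. 105 (1983)
  523–538, Thm. 0 and Thm. 3.
* [Gordon1997] B. B. Gordon, *A survey of the Hodge conjecture for abelian varieties*, arXiv:alg-geom/9709030
  (held `paper:arxiv-alg-geom_9709030`), Thm. 6.3 (3) p. 18 and pp. 18–19.
* [MoonenZarhin1999LowDim] B. Moonen, Yu. Zarhin, Math. Ann. 315 (1999), §2 (2.3) Type IV(1,1), §3 (3.1).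
* [Milne1999LefschetzClasses] J. S. Milne, *Lefschetz classes on abelian varieties*, Duke Math. J. 96 (1999),
  Prop. 3.6 (c), Remark 3.7, p. 656.
* [GoodmanWallachGTM255] R. Goodman, N. R. Wallach, GTM 255 (2009), Thm. 2.2.2, §4.1.1, Thm. 5.3.1.
* [FultonYoungTableaux1997] W. Fulton, *Young Tableaux* (1997), §8.1.
* [VoisinHodgeI2002] C. Voisin, *Hodge Theory and Complex Algebraic Geometry I*, §7.1.2 Def. 7.7.
* [Deligne1982HodgeCycles] P. Deligne, *Hodge cycles on abelian varieties*, LNM 900 (1982), §4 p. 30.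
-/

noncomputable section

open scoped TensorProduct
open scoped Matrix
open CategoryTheory Module

/-! ### §1 Block matrices with blocks of any size, placed in all slots, read along slot-and-block words -/

namespace Literature.AlgebraicGeometry.HodgeTheory

open Literature.RepresentationTheory.GeneralLinear Literature.NumberTheory.DiophantineGeometry

section WordModel

variable {K : Type*} {J T : Type*} {N d k : ℕ}

/-- **The block matrix of a family of `k × k` blocks** through an identification `φ : Fin N ≃ T × Fin k` of
the alphabet with (block, inner index): entry `(i, m)` is `(Nf τ)_{r r'}` if `φ i = (τ, r)`, `φ m = (τ, r')`,
and `0` otherwise (the tree's `blockLift` is `k = 2`). [cite: GoodmanWallachGTM255, §4.1.1] -/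
def blockLiftGen [Zero K] [DecidableEq T] (φ : Fin N ≃ T × Fin k) (Nf : T → Matrix (Fin k) (Fin k) K) :
    Matrix (Fin N) (Fin N) K :=
  Matrix.of fun i m => if (φ i).1 = (φ m).1 then Nf (φ m).1 (φ i).2 (φ m).2 else 0

/-- Entries of `blockLiftGen`. [cite: GoodmanWallachGTM255, §4.1.1] -/
theorem blockLiftGen_apply [Zero K] [DecidableEq T] (φ : Fin N ≃ T × Fin k)
    (Nf : T → Matrix (Fin k) (Fin k) K) (i m : Fin N) :
    blockLiftGen φ Nf i m = if (φ i).1 = (φ m).1 then Nf (φ m).1 (φ i).2 (φ m).2 else 0 :=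
  rfl

/-- **Refinement of a coefficient function to slot-and-block colours**: letters `J × Fin N` become
`(J × T) × Fin k` through `φ` (the tree's `placeRefine` is `k = 2`). [cite: FultonYoungTableaux1997, §8.1] -/
def placeRefineGen (φ : Fin N ≃ T × Fin k) (a : (Fin d → J × Fin N) → K) :
    (Fin d → (J × T) × Fin k) → K :=
  fun w => a fun t => ((w t).1.1, φ.symm ((w t).1.2, (w t).2))

/-- Unfolding `placeRefineGen`. [cite: FultonYoungTableaux1997, §8.1] -/
theorem placeRefineGen_apply (φ : Fin N ≃ T × Fin k) (a : (Fin d → J × Fin N) → K)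
    (w : Fin d → (J × T) × Fin k) :
    placeRefineGen φ a w = a fun t => ((w t).1.1, φ.symm ((w t).1.2, (w t).2)) :=
  rfl

/-- **A block matrix placed in all slots acts on a slice along a slot word as its blocks, placed at the
positions of their block index, act on the refined slices** (proof of the tree's `wordDerAt_blockLift_wordSlice`,
verbatim for `Fin k`). [cite: GoodmanWallachGTM255, §4.1.1] [cite: FultonYoungTableaux1997, §8.1] -/
theorem wordDerAt_blockLiftGen_wordSlice [Field K] [Fintype T] [DecidableEq T] (φ : Fin N ≃ T × Fin k)
    (Nf : T → Matrix (Fin k) (Fin k) K) (a : (Fin d → J × Fin N) → K) (u : Fin d → J) (ε : Word N d) :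
    wordDerAt K (fun _ : Fin d => blockLiftGen φ Nf) (wordSlice a u) ε =
      wordDerAt K (fun t => Nf (φ (ε t)).1) (wordSlice (placeRefineGen φ a) fun t => (u t, (φ (ε t)).1))
        fun t => (φ (ε t)).2 := by
  rw [wordDerAt_apply, wordDerAt_apply]
  refine Finset.sum_congr rfl fun t _ => ?_
  rw [← φ.symm.sum_comp, Fintype.sum_prod_type, Finset.sum_eq_single (φ (ε t)).1]
  · refine Finset.sum_congr rfl fun r _ => ?_
    rw [blockLiftGen_apply, Equiv.apply_symm_apply, if_pos rfl]
    congr 1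
    rw [wordSlice_apply, wordSlice_apply, placeRefineGen_apply]
    congr 1
    funext s
    by_cases hs : s = t
    · subst hs
      simp only [Function.update_self]
    · simp only [Function.update_of_ne hs, Prod.mk.eta, Equiv.symm_apply_apply]
  · intro τ' _ hτ'
    refine Finset.sum_eq_zero fun r _ => ?_
    rw [blockLiftGen_apply, Equiv.apply_symm_apply, if_neg (Ne.symm hτ'), zero_mul]
  · intro h
    exact absurd (Finset.mem_univ _) h

/-- **Corollary: a block matrix placed in all slots kills all slices ⟹ the family of its blocks along any
slot-and-block word kills the refined slices.** [cite: GoodmanWallachGTM255, §4.1.1] -/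
theorem wordDerAt_placeRefineGen_eq_zero [Field K] [Fintype T] [DecidableEq T] (φ : Fin N ≃ T × Fin k)
    {a : (Fin d → J × Fin N) → K} (Nf : T → Matrix (Fin k) (Fin k) K)
    (h : ∀ u : Fin d → J, wordDerAt K (fun _ : Fin d => blockLiftGen φ Nf) (wordSlice a u) = 0)
    (U : Fin d → J × T) :
    wordDerAt K (fun t => Nf (U t).2) (wordSlice (placeRefineGen φ a) U) = 0 := by
  funext η
  set ε : Word N d := fun t => φ.symm ((U t).2, η t) with hε
  have h1 := congrFun (h fun t => (U t).1) ε
  rw [wordDerAt_blockLiftGen_wordSlice] at h1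
  have hU : (fun t => ((U t).1, (φ (ε t)).1)) = U := funext fun t => by
    rw [hε, Equiv.apply_symm_apply]
  have hη : (fun t => (φ (ε t)).2) = η := funext fun t => by rw [hε, Equiv.apply_symm_apply]
  have hfam : (fun t => Nf (φ (ε t)).1) = fun t => Nf (U t).2 := funext fun t => by
    rw [hε, Equiv.apply_symm_apply]
  rw [hU, hη, hfam] at h1
  rw [h1, Pi.zero_apply, Pi.zero_apply]

/-- **The evaluation is unchanged by the refinement of the letters.** [cite: FultonYoungTableaux1997, §8.1] -/
theorem wordEval_placeRefineGen [CommRing K] [Fintype J] [Fintype T] {H M : Type*} [AddCommGroup H]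
    [Module K H] [AddCommGroup M] [Module K M] (F : H [⋀^Fin d]→ₗ[K] M) (φ : Fin N ≃ T × Fin k)
    (x : J × Fin N → H) (a : (Fin d → J × Fin N) → K) :
    wordEval F (fun jr : (J × T) × Fin k => x (jr.1.1, φ.symm (jr.1.2, jr.2))) (placeRefineGen φ a) =
      wordEval F x a := by
  let θ : (J × T) × Fin k ≃ J × Fin N :=
    { toFun := fun jr => (jr.1.1, φ.symm (jr.1.2, jr.2))
      invFun := fun jm => ((jm.1, (φ jm.2).1), (φ jm.2).2)
      left_inv := fun jr => by simp
      right_inv := fun jm => by simp }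
  rw [wordEval_apply, wordEval_apply]
  exact Fintype.sum_equiv (Equiv.arrowCongr (Equiv.refl (Fin d)) θ) _ _ fun w => rfl

/-- **The matrix of `Matrix.toLin` of a block matrix acts on the collected basis blockwise**:
`toLin (blockLiftGen φ Nf) (cb (τ, ℓ)) = ∑_k (Nf τ)_{k ℓ} cb (τ, k)` for a basis `cbσ` with `cbσ m = cb (φ m)`.
[cite: GoodmanWallachGTM255, §4.1.1] -/
theorem toLin_blockLiftGen_apply [Field K] [Fintype T] [DecidableEq T] {W : Type*} [AddCommGroup W]
    [Module K W] (φ : Fin N ≃ T × Fin k) (cbσ : Module.Basis (Fin N) K W) (cb : T × Fin k → W)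
    (hcbσ : ∀ m, cbσ m = cb (φ m)) (Nf : T → Matrix (Fin k) (Fin k) K) (τ : T) (ℓ : Fin k) :
    Matrix.toLin cbσ cbσ (blockLiftGen φ Nf) (cb (τ, ℓ)) = ∑ r, Nf τ r ℓ • cb (τ, r) := by
  have hm : cb (τ, ℓ) = cbσ (φ.symm (τ, ℓ)) := by rw [hcbσ, Equiv.apply_symm_apply]
  rw [hm, Matrix.toLin_self]
  simp only [hcbσ, blockLiftGen_apply, Equiv.apply_symm_apply]
  rw [← φ.symm.sum_comp, Fintype.sum_prod_type, Finset.sum_eq_single τ]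
  · exact Finset.sum_congr rfl fun r _ => by rw [Equiv.apply_symm_apply, if_pos rfl]
  · intro τ' _ hτ'
    exact Finset.sum_eq_zero fun r _ => by rw [Equiv.apply_symm_apply, if_neg hτ', zero_smul]
  · intro h
    exact absurd (Finset.mem_univ _) h

end WordModel

end Literature.AlgebraicGeometry.HodgeTheory

/-! ### §2 Adapted `ψ_ℂ`-dual bases of `V_ℂ = W ⊕ W'` for an imaginary quadratic structure of weight one -/

namespace Literature.AlgebraicGeometry.Motives

namespace HodgeStructure

section DualBases

universe u

variable {V : Type u} [AddCommGroup V] [Module ℚ V] {n : ℤ}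

/-- **The graded pieces of `W` and `W'` are in perfect `ψ_ℂ`-duality**: for `p + q = 1` the map
`y' ↦ ψ_ℂ(·, y')`, `W' ∩ V^{q,p} → (W ∩ V^{p,q})^*`, is bijective — injective by the second Hodge–Riemann
relation (`ψ_ℂ(conj y', y') ≠ 0`, `conj y' ∈ W ∩ V^{p,q}`), and the dimensions agree (`W' ∩ V^{q,p} =
conj(W ∩ V^{p,q})`). Gordon: `W''` is dual to `W'`. [cite: Gordon1997, §6 (proof of Thm. 6.3.3, p. 19)]
[cite: VoisinHodgeI2002, §7.1.2 Def. 7.7] [cite: Deligne1982HodgeCycles, §4 (p. 30)] -/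
theorem UnitaryTheta.pairing_bijective [Module.Finite ℚ V] (H : HodgeStructure V n) (hn : n = 1)
    (ψ : H.Polarization) (φ : Module.End ℚ V) {d : ℚ} (hd : 0 < d) {μ : ℂ} (hμ : μ ^ 2 = -(d : ℂ))
    (p q : ℤ) (hpq : p + q = 1) :
    Function.Bijective
      (((ψ.form.baseChange ℂ).domRestrict₁₂ (Module.End.eigenspace (φ.baseChange ℂ) μ ⊓ H.piece p q)
        (Module.End.eigenspace (φ.baseChange ℂ) (-μ) ⊓ H.piece q p)).flip :
        ↥(Module.End.eigenspace (φ.baseChange ℂ) (-μ) ⊓ H.piece q p) →ₗ[ℂ]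
          Module.Dual ℂ ↥(Module.End.eigenspace (φ.baseChange ℂ) μ ⊓ H.piece p q)) := by
  subst hn
  obtain ⟨-, hμc⟩ := UnitaryTheta.conj_eq_neg_of_sq hd hμ
  set S := Module.End.eigenspace (φ.baseChange ℂ) μ ⊓ H.piece p q with hSdef
  set S' := Module.End.eigenspace (φ.baseChange ℂ) (-μ) ⊓ H.piece q p with hS'def
  set Φ := ((ψ.form.baseChange ℂ).domRestrict₁₂ S S').flip with hΦdef
  have hΦ : ∀ (y' : S') (x : S), Φ y' x = ψ.form.baseChange ℂ x y' := fun y' x => by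
    rw [hΦdef, LinearMap.flip_apply, LinearMap.domRestrict₁₂_apply]
  have hconj : ∀ y' ∈ S', conj y' ∈ S := fun y' hy' =>
    ⟨(UnitaryTheta.conj_mem_eigenspace_iff' φ hμc y').2 hy'.1, H.conj_mem_piece hy'.2⟩
  have hinj : Function.Injective Φ := by
    rw [injective_iff_map_eq_zero]
    intro y' hy'
    have h : ψ.form.baseChange ℂ (conj (y' : ℂ ⊗[ℚ] V)) y' = 0 := by
      rw [← hΦ y' ⟨_, hconj _ y'.2⟩, hy', LinearMap.zero_apply]
    have h0 : conj (y' : ℂ ⊗[ℚ] V) = 0 := by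
      by_contra hne
      refine ψ.form_conj_ne_zero hpq (hconj _ y'.2).2 hne ?_
      rw [conj_conj]
      exact h
    exact Subtype.ext (by rw [← conj_conj (y' : ℂ ⊗[ℚ] V), h0, map_zero]; rfl)
  have hdim : Module.finrank ℂ S' = Module.finrank ℂ S := by
    have h : S' = complexConj S := by
      rw [hS'def, hSdef, complexConj_inf, complexConj_piece, EndAction.complexConj_eigenspace_baseChange, hμc]
    rw [h, finrank_complexConj]
  exact ⟨hinj, (LinearMap.injective_iff_surjective_of_finrank_eq_finrank
    (hdim.trans (Subspace.dual_finrank_eq (K := ℂ) (V := ↥S)).symm)).1 hinj⟩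

/-- **Adapted `ψ_ℂ`-dual bases of `V_ℂ = W ⊕ W'`.** For an effective polarized weight-one `ℚ`-Hodge structure
with an imaginary quadratic structure `φ` (`φ² = -d < 0`, `End_Hdg = ℚ + ℚφ`, `μ² = -d`, `W = ker(φ_ℂ - μ)`,
`W' = ker(φ_ℂ + μ)`) there are a basis `(cb (0, ℓ), cb (1, ℓ))_ℓ = (e_ℓ, f_ℓ)_ℓ` of `V_ℂ` and kinds `κ_ℓ` with
`e_ℓ ∈ W`, `f_ℓ ∈ W'`, `e_ℓ ∈ V^{1,0}`, `f_ℓ ∈ V^{0,1}` for `κ_ℓ = 0`, `e_ℓ ∈ V^{0,1}`, `f_ℓ ∈ V^{1,0}` for `κ_ℓ = 1`,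
and `ψ_ℂ(e_i, f_j) = δ_{ij}`: bases of `W ∩ V^{1,0}`, `W ∩ V^{0,1}` and their `ψ_ℂ`-dual bases of
`W' ∩ V^{0,1}`, `W' ∩ V^{1,0}` (`pairing_bijective`); they span since `V_ℂ = W ⊕ W'` and both are `Θ`-graded,
and are independent by duality. In these letters every `Y ∈ 𝔲_K(V, ψ)_ℂ` has matrix `X ⊕ (-Xᵀ)` (Gordon:
"`W ⊗ ℂ = W' ⊕ W''` … `W' = (W' ∩ H^{-1,0}) ⊕ (W' ∩ H^{0,-1})`"; Milne: "the standard representation and its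
contragredient"). [cite: Gordon1997, §6 (proof of Thm. 6.3.3, p. 19)] [cite: Milne1999LefschetzClasses, §2 p. 651]
[cite: VoisinHodgeI2002, §7.1.2 Def. 7.7] -/
theorem UnitaryTheta.exists_adaptedDualBasis [Module.Finite ℚ V] [HodgeTensorFacts.{u, u}] (H : HodgeStructure V n)
    (hn : n = 1) (heff : H.IsEffective) (ψ : H.Polarization) {φ : Module.End ℚ V} (hφE : φ ∈ H.endAlg)
    {d : ℚ} (hd : 0 < d) (hφ2 : φ * φ = -(d • 1)) (hE : ∀ a ∈ H.endAlg, ∃ x y : ℚ, a = x • 1 + y • φ)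
    {μ : ℂ} (hμ : μ ^ 2 = -(d : ℂ)) :
    ∃ (n₀ : ℕ) (cb : Module.Basis (Fin 2 × Fin n₀) ℂ (ℂ ⊗[ℚ] V)) (κ : Fin n₀ → Fin 2),
      (∀ ℓ, cb (0, ℓ) ∈ Module.End.eigenspace (φ.baseChange ℂ) μ) ∧
      (∀ ℓ, cb (1, ℓ) ∈ Module.End.eigenspace (φ.baseChange ℂ) (-μ)) ∧
      (∀ ℓ, κ ℓ = 0 → cb (0, ℓ) ∈ H.piece 1 0 ∧ cb (1, ℓ) ∈ H.piece 0 1) ∧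
      (∀ ℓ, κ ℓ = 1 → cb (0, ℓ) ∈ H.piece 0 1 ∧ cb (1, ℓ) ∈ H.piece 1 0) ∧
      (∀ i j, ψ.form.baseChange ℂ (cb (0, i)) (cb (1, j)) = if i = j then 1 else 0) := by
  classical
  -- the degenerate case `V = 0`
  rcases subsingleton_or_nontrivial V with hV | hV
  · haveI : Subsingleton (ℂ ⊗[ℚ] V) := by
      refine ⟨fun x y => ?_⟩
      have h : ∀ z : ℂ ⊗[ℚ] V, z = 0 := fun z => by
        induction z using TensorProduct.induction_on with
        | zero => rfl
        | tmul c v => rw [Subsingleton.elim v 0, TensorProduct.tmul_zero]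
        | add a b ha hb => rw [ha, hb, add_zero]
      rw [h x, h y]
    exact ⟨0, Module.Basis.empty _, Fin.elim0, fun ℓ => ℓ.elim0, fun ℓ => ℓ.elim0, fun ℓ => ℓ.elim0,
      fun ℓ => ℓ.elim0, fun i => i.elim0⟩
  subst hn
  obtain ⟨Θ, hΘ⟩ := exists_hodgeTheta H
  obtain ⟨hP, hQ, hΘ10, hΘ01, -⟩ := UnitaryTheta.theta_facts H rfl heff hΘ
  obtain ⟨hμ0, hμc⟩ := UnitaryTheta.conj_eq_neg_of_sq hd hμ
  set φC := φ.baseChange ℂ with hφC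
  set W := Module.End.eigenspace φC μ with hWdef
  set W' := Module.End.eigenspace φC (-μ) with hW'def
  set ψC := ψ.form.baseChange ℂ with hψC
  -- `Θ` preserves `W`, `W'`; isotropy
  have hΘφ : Θ * φC = φC * Θ :=
    commute_baseChange_of_mem_hodgeLieC H (H.mem_hodgeLieC_of_forall_piece hΘ) ⟨φ, hφE⟩
  have hΘW : ∀ w ∈ W, Θ w ∈ W := fun w hw => UnitaryTheta.apply_mem_eigenspace_of_commute hΘφ hw
  have hΘW' : ∀ w ∈ W', Θ w ∈ W' := fun w hw => UnitaryTheta.apply_mem_eigenspace_of_commute hΘφ hw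
  have hφskewC : ∀ x y, ψC (φC x) y + ψC x (φC y) = 0 :=
    ThetaSubalgebra.formBaseChange_add_eq_zero_of_skew ψ
      (UnitaryTheta.form_apply_add_form_apply_eq_zero H ψ hφE hd hφ2 hE)
  have hisoW : ∀ x ∈ W, ∀ y ∈ W, ψC x y = 0 := fun x hx y hy =>
    UnitaryTheta.form_eq_zero_of_mem_eigenspace hφskewC hμ0 hx hy
  have hisoW' : ∀ x ∈ W', ∀ y ∈ W', ψC x y = 0 := fun x hx y hy =>
    UnitaryTheta.form_eq_zero_of_mem_eigenspace hφskewC (neg_ne_zero.2 hμ0) hx hy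
  have hswap : ∀ x y, ψC y x = -ψC x y := fun x y => by
    rw [hψC, ψ.form_baseChange_swap, show (1 : ℤ).negOnePow = -1 from Int.negOnePow_one]
    simp
  have h1100 : ∀ x ∈ H.piece 1 0, ∀ y ∈ H.piece 1 0, ψC x y = 0 := fun x hx y hy =>
    ψ.form_piece_piece (p := 1) (p' := 1) (by norm_num) (by simpa using hx) (by simpa using hy)
  have h0101 : ∀ x ∈ H.piece 0 1, ∀ y ∈ H.piece 0 1, ψC x y = 0 := fun x hx y hy =>
    ψ.form_piece_piece (p := 0) (p' := 0) (by norm_num) (by simpa using hx) (by simpa using hy)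
  -- the four graded pieces and their bases
  set W₁ := W ⊓ H.piece 1 0 with hW₁def
  set L := W ⊓ H.piece 0 1 with hLdef
  set W₁' := W' ⊓ H.piece 0 1 with hW₁'def
  set L' := W' ⊓ H.piece 1 0 with hL'def
  set m₁ := Module.finrank ℂ W₁ with hm₁
  set m₂ := Module.finrank ℂ L with hm₂
  set b₁ : Module.Basis (Fin m₁) ℂ W₁ := Module.finBasis ℂ W₁ with hb₁def
  set b₂ : Module.Basis (Fin m₂) ℂ L := Module.finBasis ℂ L with hb₂def
  set Φ₁ := LinearEquiv.ofBijective _ (UnitaryTheta.pairing_bijective H rfl ψ φ hd hμ 1 0 (by norm_num))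
    with hΦ₁def
  set Φ₂ := LinearEquiv.ofBijective _ (UnitaryTheta.pairing_bijective H rfl ψ φ hd hμ 0 1 (by norm_num))
    with hΦ₂def
  have hΦ₁ : ∀ (y' : W₁') (x : W₁), Φ₁ y' x = ψC x y' := fun y' x => by
    rw [hΦ₁def, LinearEquiv.ofBijective_apply, LinearMap.flip_apply, LinearMap.domRestrict₁₂_apply]
  have hΦ₂ : ∀ (y' : L') (x : L), Φ₂ y' x = ψC x y' := fun y' x => by
    rw [hΦ₂def, LinearEquiv.ofBijective_apply, LinearMap.flip_apply, LinearMap.domRestrict₁₂_apply]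
  set fb₁ : Module.Basis _ ℂ W₁' := b₁.dualBasis.map Φ₁.symm with hfb₁def
  set fb₂ : Module.Basis _ ℂ L' := b₂.dualBasis.map Φ₂.symm with hfb₂def
  have hfb₁ : ∀ i (x : W₁), ψC x (fb₁ i) = b₁.repr x i := fun i x => by
    rw [← hΦ₁, hfb₁def, Module.Basis.map_apply, LinearEquiv.apply_symm_apply, Module.Basis.dualBasis_apply]
  have hfb₂ : ∀ i (x : L), ψC x (fb₂ i) = b₂.repr x i := fun i x => by
    rw [← hΦ₂, hfb₂def, Module.Basis.map_apply, LinearEquiv.apply_symm_apply, Module.Basis.dualBasis_apply]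
  -- the combined family, indexed by `Fin 2 × (Fin m₁ ⊕ Fin m₂)`
  set e : Fin m₁ ⊕ Fin m₂ → ℂ ⊗[ℚ] V := Sum.elim (fun i => (b₁ i : ℂ ⊗[ℚ] V)) (fun j => (b₂ j : ℂ ⊗[ℚ] V))
    with hedef
  set f : Fin m₁ ⊕ Fin m₂ → ℂ ⊗[ℚ] V := Sum.elim (fun i => (fb₁ i : ℂ ⊗[ℚ] V)) (fun j => (fb₂ j : ℂ ⊗[ℚ] V))
    with hfdef
  set κ₀ : Fin m₁ ⊕ Fin m₂ → Fin 2 := Sum.elim (fun _ => 0) (fun _ => 1) with hκ₀def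
  have heW : ∀ ℓ, e ℓ ∈ W := by
    rintro (i | j)
    · exact (b₁ i).2.1
    · exact (b₂ j).2.1
  have hfW' : ∀ ℓ, f ℓ ∈ W' := by
    rintro (i | j)
    · exact (fb₁ i).2.1
    · exact (fb₂ j).2.1
  have he0 : ∀ ℓ, κ₀ ℓ = 0 → e ℓ ∈ H.piece 1 0 ∧ f ℓ ∈ H.piece 0 1 := by
    rintro (i | j) h
    · exact ⟨(b₁ i).2.2, (fb₁ i).2.2⟩
    · simp [hκ₀def] at h
  have he1 : ∀ ℓ, κ₀ ℓ = 1 → e ℓ ∈ H.piece 0 1 ∧ f ℓ ∈ H.piece 1 0 := by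
    rintro (i | j) h
    · simp [hκ₀def] at h
    · exact ⟨(b₂ j).2.2, (fb₂ j).2.2⟩
  have hdual : ∀ i j, ψC (e i) (f j) = if i = j then 1 else 0 := by
    rintro (i | i) (j | j)
    · change ψC (b₁ i : ℂ ⊗[ℚ] V) (fb₁ j) = _
      rw [hfb₁, Module.Basis.repr_self, Finsupp.single_apply]
      by_cases h : i = j
      · subst h; simp
      · rw [if_neg h, if_neg (fun h' => h (Sum.inl_injective h'))]
    · change ψC (b₁ i : ℂ ⊗[ℚ] V) (fb₂ j) = _
      rw [h1100 _ (b₁ i).2.2 _ (fb₂ j).2.2, if_neg Sum.inl_ne_inr]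
    · change ψC (b₂ i : ℂ ⊗[ℚ] V) (fb₁ j) = _
      rw [h0101 _ (b₂ i).2.2 _ (fb₁ j).2.2, if_neg Sum.inr_ne_inl]
    · change ψC (b₂ i : ℂ ⊗[ℚ] V) (fb₂ j) = _
      rw [hfb₂, Module.Basis.repr_self, Finsupp.single_apply]
      by_cases h : i = j
      · subst h; simp
      · rw [if_neg h, if_neg (fun h' => h (Sum.inr_injective h'))]
  set cbf : Fin 2 × (Fin m₁ ⊕ Fin m₂) → ℂ ⊗[ℚ] V := fun tl => if tl.1 = 0 then e tl.2 else f tl.2 with hcbfdef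
  have hcbf0 : ∀ ℓ, cbf (0, ℓ) = e ℓ := fun ℓ => by simp [hcbfdef]
  have hcbf1 : ∀ ℓ, cbf (1, ℓ) = f ℓ := fun ℓ => by simp [hcbfdef]
  -- linear independence by duality
  have hli : LinearIndependent ℂ cbf := by
    rw [Fintype.linearIndependent_iff]
    intro c hc
    rw [Fintype.sum_prod_type, Fin.sum_univ_two] at hc
    simp only [hcbf0, hcbf1] at hc
    have hxW : ∑ ℓ, c (0, ℓ) • e ℓ ∈ W := Submodule.sum_mem _ fun ℓ _ => Submodule.smul_mem _ _ (heW ℓ)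
    have hyW' : ∑ ℓ, c (1, ℓ) • f ℓ ∈ W' := Submodule.sum_mem _ fun ℓ _ => Submodule.smul_mem _ _ (hfW' ℓ)
    have hx0 : ∑ ℓ, c (0, ℓ) • e ℓ = 0 := by
      refine UnitaryTheta.eq_zero_of_mem_eigenspace_of_mem_eigenspace_neg hμ0 hxW ?_
      have h : ∑ ℓ, c (0, ℓ) • e ℓ = -∑ ℓ, c (1, ℓ) • f ℓ := eq_neg_of_add_eq_zero_left hc
      rw [h]
      exact Submodule.neg_mem _ hyW'
    have hy0 : ∑ ℓ, c (1, ℓ) • f ℓ = 0 := by rwa [hx0, zero_add] at hc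
    rintro ⟨t, ℓ⟩
    rcases Fin.eq_zero_or_eq_succ t with rfl | ⟨j, rfl⟩
    · have h := congrArg (fun z => ψC z (f ℓ)) hx0
      simp only [map_sum, map_smul, LinearMap.sum_apply, LinearMap.smul_apply, smul_eq_mul, hdual,
        mul_ite, mul_one, mul_zero, Finset.sum_ite_eq', Finset.mem_univ, if_true, map_zero,
        LinearMap.zero_apply] at h
      exact h
    · obtain rfl : j = 0 := Fin.eq_zero j
      have h := congrArg (fun z => ψC (e ℓ) z) hy0
      simp only [map_sum, map_smul, smul_eq_mul, hdual, mul_ite, mul_one, mul_zero, Finset.sum_ite_eq,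
        Finset.mem_univ, if_true, map_zero] at h
      exact h
  -- spanning: `V_ℂ = W ⊕ W'`, `W = W₁ ⊕ L`, `W' = L' ⊕ W₁'`
  have hspan : ⊤ ≤ Submodule.span ℂ (Set.range cbf) := by
    rintro v -
    have hsub : ∀ (S : Submodule ℂ (ℂ ⊗[ℚ] V)) {ι : Type} [Fintype ι] (bS : Module.Basis ι ℂ S)
        (emb : ι → Fin 2 × (Fin m₁ ⊕ Fin m₂)) (hemb : ∀ i, cbf (emb i) = bS i) (x : ℂ ⊗[ℚ] V) (hx : x ∈ S),
        x ∈ Submodule.span ℂ (Set.range cbf) := by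
      intro S ι _ bS emb hemb x hx
      have h := congrArg Subtype.val (bS.sum_repr ⟨x, hx⟩)
      simp only [Submodule.coe_sum, Submodule.coe_smul] at h
      rw [← h]
      refine Submodule.sum_mem _ fun i _ => Submodule.smul_mem _ _ ?_
      rw [← hemb]
      exact Submodule.subset_span ⟨emb i, rfl⟩
    obtain ⟨w, hw, w', hw', rfl⟩ := UnitaryTheta.exists_eigen_add_eigen hφ2 hμ hμ0 v
    have hPw : (2 : ℂ)⁻¹ • (w + Θ w) ∈ W₁ := ⟨Submodule.smul_mem _ _ (Submodule.add_mem _ hw (hΘW w hw)), hP w⟩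
    have hQw : (2 : ℂ)⁻¹ • (w - Θ w) ∈ L := ⟨Submodule.smul_mem _ _ (Submodule.sub_mem _ hw (hΘW w hw)), hQ w⟩
    have hPw' : (2 : ℂ)⁻¹ • (w' + Θ w') ∈ L' :=
      ⟨Submodule.smul_mem _ _ (Submodule.add_mem _ hw' (hΘW' w' hw')), hP w'⟩
    have hQw' : (2 : ℂ)⁻¹ • (w' - Θ w') ∈ W₁' :=
      ⟨Submodule.smul_mem _ _ (Submodule.sub_mem _ hw' (hΘW' w' hw')), hQ w'⟩
    have hw_eq : w = (2 : ℂ)⁻¹ • (w + Θ w) + (2 : ℂ)⁻¹ • (w - Θ w) := by module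
    have hw'_eq : w' = (2 : ℂ)⁻¹ • (w' + Θ w') + (2 : ℂ)⁻¹ • (w' - Θ w') := by module
    rw [hw_eq, hw'_eq]
    refine Submodule.add_mem _ (Submodule.add_mem _ ?_ ?_) (Submodule.add_mem _ ?_ ?_)
    · exact hsub W₁ b₁ (fun i => (0, Sum.inl i)) (fun i => by rw [hcbf0]; rfl) _ hPw
    · exact hsub L b₂ (fun j => (0, Sum.inr j)) (fun j => by rw [hcbf0]; rfl) _ hQw
    · exact hsub L' fb₂ (fun j => (1, Sum.inr j)) (fun j => by rw [hcbf1]; rfl) _ hPw'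
    · exact hsub W₁' fb₁ (fun i => (1, Sum.inl i)) (fun i => by rw [hcbf1]; rfl) _ hQw'
  -- reindex by `Fin (m₁ + m₂)`
  set cbι := Module.Basis.mk hli hspan with hcbιdef
  set σ : Fin m₁ ⊕ Fin m₂ ≃ Fin (m₁ + m₂) := finSumFinEquiv with hσ
  refine ⟨m₁ + m₂, cbι.reindex ((Equiv.refl (Fin 2)).prodCongr σ), κ₀ ∘ σ.symm, fun ℓ => ?_, fun ℓ => ?_,
    fun ℓ h => ?_, fun ℓ h => ?_, fun i j => ?_⟩
  · rw [Module.Basis.reindex_apply, Equiv.prodCongr_symm, Equiv.prodCongr_apply, Equiv.refl_symm,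
      Equiv.coe_refl, Prod.map_apply, id, hcbιdef, Module.Basis.mk_apply, hcbf0]
    exact heW _
  · rw [Module.Basis.reindex_apply, Equiv.prodCongr_symm, Equiv.prodCongr_apply, Equiv.refl_symm,
      Equiv.coe_refl, Prod.map_apply, id, hcbιdef, Module.Basis.mk_apply, hcbf1]
    exact hfW' _
  · simp only [Module.Basis.reindex_apply, Equiv.prodCongr_symm, Equiv.prodCongr_apply, Equiv.refl_symm,
      Equiv.coe_refl, Prod.map_apply, id, hcbιdef, Module.Basis.mk_apply, hcbf0, hcbf1]
    exact he0 _ h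
  · simp only [Module.Basis.reindex_apply, Equiv.prodCongr_symm, Equiv.prodCongr_apply, Equiv.refl_symm,
      Equiv.coe_refl, Prod.map_apply, id, hcbιdef, Module.Basis.mk_apply, hcbf0, hcbf1]
    exact he1 _ h
  · simp only [Module.Basis.reindex_apply, Equiv.prodCongr_symm, Equiv.prodCongr_apply, Equiv.refl_symm,
      Equiv.coe_refl, Prod.map_apply, id, hcbιdef, Module.Basis.mk_apply, hcbf0, hcbf1, hdual,
      σ.symm.injective.eq_iff]

end DualBases

end HodgeStructure

end Literature.AlgebraicGeometry.Motives

/-! ### §3 The invariance theorem: slices of the coefficient function of a Hodge class are killed by `𝔤𝔩(W)` acting by `X ⊕ (-Xᵀ)` -/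

namespace Literature.AlgebraicGeometry.HodgeTheory

open Literature.AlgebraicTopology.SingularHomology
open Literature.AlgebraicGeometry.Motives (IsSmoothProjective AbelianVariety bettiCohomology
  ofRatClassBaseChange ofRatClassBaseChange_tmul HodgeTensorFacts hodgeTensorFacts_holds)
open Literature.Barriers.HodgeConjecture
open Literature.AlgebraicGeometry.Motives.HodgeStructure
open Literature.RepresentationTheory.GeneralLinear
open Literature.RepresentationTheory.ClassicalInvariants
open Literature.NumberTheory.DiophantineGeometry

section Invariance

variable {A B : AbelianVariety ℂ} {n : ℕ} {g : Fin n → (B ⟶ A)}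

/-- The two elements of `Fin 2`. [folklore] -/
private theorem fin2_cases' (r : Fin 2) : r = 0 ∨ r = 1 := by
  fin_cases r <;> simp

open scoped Classical in
/-- **THE INVARIANCE THEOREM (Ribet 1983 Thm. 3, Lie step, for abelian varieties with slots over `A` of unitary
type `(m, 1)`).** Let `A` be a complex abelian variety whose `H = H¹(A(ℂ); ℚ)` carries a polarization `ψ` and an
imaginary quadratic structure `φ ∈ End_Hdg(H)` (`φ² = -d < 0`, `End_Hdg(H) = ℚ + ℚφ`) with
`dim(W ∩ H^{0,1}) = 1`, `dim(W ∩ H^{1,0}) ≥ 2` (`W = ker(φ_ℂ - μ)`, `μ² = -d`), let `(e_ℓ, f_ℓ) = (cb(0,ℓ), cb(1,ℓ))`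
be adapted `ψ_ℂ`-dual bases of `W ⊕ W'` (`exists_adaptedDualBasis`), and `B` an abelian variety with slots `g`
over `A`. Then every rational `(p,p)`-class `c` on `B` (`p ≥ 1`) is `∑_w a(w) · (g e, g f)_w` for a coefficient
function `a` on words in the letters `((j, t), ℓ)` (slot, type, index) such that for every slot-and-type word
`U` and EVERY `X ∈ 𝔤𝔩_{n₀}(ℂ)` the typed differential of `X` (`X` at the positions of type `0` = vector = `W`,
`-Xᵀ` at the positions of type `1` = covector = `W'`) kills the slice `a(U, −)`: the operator `Y_X` of `H_ℂ`
with matrix `X ⊕ (-Xᵀ)` in the letters commutes with `φ_ℂ` and is `ψ_ℂ`-skew (duality and isotropy of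
`W`, `W'`), so THEOREM L′ (`HodgeStructure.UnitaryTheta.wordDerAt_eq_zero_of_commute_of_skew`: the rational
annihilator of the rational coefficient tensor is a Lie algebra containing `Θ` after complexification, hence
all of `𝔲_K(H, ψ)_ℂ ≅ 𝔤𝔩(W)`) applies; the transport between adapted and rational letters is that of the
tree's `AVSlots.exists_invariant_coeff_of_real_characters`. Gordon: "the induced map `MT(A, ℂ) → GL(W')`
is surjective". [cite: Ribet1983, Thm. 3] [cite: Gordon1997, §6 (proof of Thm. 6.3.3, pp. 18–19)]
[cite: MoonenZarhin1999LowDim, §2 (2.3) and §3 (3.1)] -/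
theorem AVSlots.exists_unitaryInvariant_coeff [HodgeTensorFacts.{0, 0}] (hg : AVSlots A B g)
    (hHD : exists_isReal_hodgeModel) (hI : hodgePQ_independent_of_hodgeModel)
    (ψ : (BettiUniverse.hodge hHD (AbelianVariety.isSmoothProjective_holds (A := A)) 1).Polarization)
    {φ : Module.End ℚ (bettiCohomology A.X 1)}
    (hφE : φ ∈ (BettiUniverse.hodge hHD (AbelianVariety.isSmoothProjective_holds (A := A)) 1).endAlg)
    {d : ℚ} (hd : 0 < d) (hφ2 : φ * φ = -(d • 1))
    (hE : ∀ a ∈ (BettiUniverse.hodge hHD (AbelianVariety.isSmoothProjective_holds (A := A)) 1).endAlg,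
      ∃ x y : ℚ, a = x • 1 + y • φ)
    {μ : ℂ} (hμ : μ ^ 2 = -(d : ℂ))
    (h1 : Module.finrank ℂ ↥(Module.End.eigenspace (φ.baseChange ℂ) μ ⊓
      (BettiUniverse.hodge hHD (AbelianVariety.isSmoothProjective_holds (A := A)) 1).piece 0 1) = 1)
    (h2 : 2 ≤ Module.finrank ℂ ↥(Module.End.eigenspace (φ.baseChange ℂ) μ ⊓
      (BettiUniverse.hodge hHD (AbelianVariety.isSmoothProjective_holds (A := A)) 1).piece 1 0))
    {n₀ : ℕ} (cb : Module.Basis (Fin 2 × Fin n₀) ℂ (ℂ ⊗[ℚ] bettiCohomology A.X 1)) (κ : Fin n₀ → Fin 2)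
    (hcbW : ∀ ℓ, cb (0, ℓ) ∈ Module.End.eigenspace (φ.baseChange ℂ) μ)
    (hcbW' : ∀ ℓ, cb (1, ℓ) ∈ Module.End.eigenspace (φ.baseChange ℂ) (-μ))
    (hcb0 : ∀ ℓ, κ ℓ = 0 →
      cb (0, ℓ) ∈ (BettiUniverse.hodge hHD (AbelianVariety.isSmoothProjective_holds (A := A)) 1).piece 1 0 ∧
      cb (1, ℓ) ∈ (BettiUniverse.hodge hHD (AbelianVariety.isSmoothProjective_holds (A := A)) 1).piece 0 1)
    (hcb1 : ∀ ℓ, κ ℓ = 1 →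
      cb (0, ℓ) ∈ (BettiUniverse.hodge hHD (AbelianVariety.isSmoothProjective_holds (A := A)) 1).piece 0 1 ∧
      cb (1, ℓ) ∈ (BettiUniverse.hodge hHD (AbelianVariety.isSmoothProjective_holds (A := A)) 1).piece 1 0)
    (hdual : ∀ i j, ψ.form.baseChange ℂ (cb (0, i)) (cb (1, j)) = if i = j then 1 else 0)
    {p : ℕ} (hp : 0 < p) {c : complexBetti B.X (2 * p)} (hcQ : IsRationalClass c)
    (hc : IsOfHodgeType B.dim B.X (2 * p) p p c) :
    ∃ a : (Fin (2 * p) → (Fin n × Fin 2) × Fin n₀) → ℂ,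
      wordEval (cupPowOneAlt ℂ (Motives.ComplexPoints B.X) (2 * p))
        (fun x : (Fin n × Fin 2) × Fin n₀ => avLetters g (fun tl : Fin 2 × Fin n₀ =>
          ofRatClassBaseChange (Motives.ComplexPoints A.X) 1 (cb tl)) (x.1.1, (x.1.2, x.2))) a = c ∧
      ∀ (U : Fin (2 * p) → Fin n × Fin 2) (X : Matrix (Fin n₀) (Fin n₀) ℂ),
        wordDerAt ℂ (fun t => if (U t).2 = 0 then X else -Xᵀ) (wordSlice a U) = 0 := by
  classical
  -- the setting
  have hX : IsSmoothProjective A.dim A.X := AbelianVariety.isSmoothProjective_holds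
  haveI : Module.Finite ℚ (bettiCohomology A.X 1) := finite_bettiCohomology_one A
  have hn1 : (((1 : ℕ) : ℤ)) = 1 := Nat.cast_one
  have heff := BettiUniverse.hodge_isEffective hHD hX 1
  obtain ⟨hμ0, -⟩ := UnitaryTheta.conj_eq_neg_of_sq hd hμ
  set F := cupPowOneAlt ℂ (Motives.ComplexPoints B.X) (2 * p) with hFdef
  have hFinj : Function.Injective (exteriorPower.alternatingMapLinearEquiv F) :=
    injective_alternatingMapLinearEquiv_cupPowOneAlt B (2 * p)
  -- bases: the adapted basis `cbσ` and the rational basis `eC`, both indexed by `Fin M`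
  set eQ := Module.finBasis ℚ (bettiCohomology A.X 1) with heQ
  set eC : Module.Basis (Fin (Module.finrank ℚ (bettiCohomology A.X 1))) ℂ
    (ℂ ⊗[ℚ] bettiCohomology A.X 1) := Algebra.TensorProduct.basis ℂ eQ with heC
  set φι : Fin (Module.finrank ℚ (bettiCohomology A.X 1)) ≃ Fin 2 × Fin n₀ := eC.indexEquiv cb with hφι
  set cbσ : Module.Basis (Fin (Module.finrank ℚ (bettiCohomology A.X 1))) ℂ
    (ℂ ⊗[ℚ] bettiCohomology A.X 1) := cb.reindex φι.symm with hcbσdef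
  have hcbσ : ∀ m, cbσ m = cb (φι m) := fun m => by
    rw [hcbσdef, Module.Basis.reindex_apply, Equiv.symm_symm]
  -- kinds of the adapted letters
  set κ2 : Fin 2 × Fin n₀ → Fin 2 := fun tl => if tl.1 = 0 then κ tl.2 else (if κ tl.2 = 0 then 1 else 0)
    with hκ2
  have hkind : ∀ tl : Fin 2 × Fin n₀,
      (κ2 tl = 0 → cb tl ∈ (BettiUniverse.hodge hHD (AbelianVariety.isSmoothProjective_holds (A := A)) 1).piece 1 0) ∧
      (κ2 tl = 1 → cb tl ∈ (BettiUniverse.hodge hHD (AbelianVariety.isSmoothProjective_holds (A := A)) 1).piece 0 1) := by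
    rintro ⟨t, ℓ⟩
    rcases fin2_cases' t with rfl | rfl <;> rcases fin2_cases' (κ ℓ) with h | h
    · have hk : κ2 (0, ℓ) = 0 := by simp [hκ2, h]
      rw [hk]
      exact ⟨fun _ => (hcb0 ℓ h).1, fun h' => absurd h' (by decide)⟩
    · have hk : κ2 (0, ℓ) = 1 := by simp [hκ2, h]
      rw [hk]
      exact ⟨fun h' => absurd h' (by decide), fun _ => (hcb1 ℓ h).1⟩
    · have hk : κ2 (1, ℓ) = 1 := by simp [hκ2, h]
      rw [hk]
      exact ⟨fun h' => absurd h' (by decide), fun _ => (hcb0 ℓ h).2⟩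
    · have hk : κ2 (1, ℓ) = 0 := by simp [hκ2, h]
      rw [hk]
      exact ⟨fun _ => (hcb1 ℓ h).2, fun h' => absurd h' (by decide)⟩
  set κ' : Fin (Module.finrank ℚ (bettiCohomology A.X 1)) → Fin 2 := fun m => κ2 (φι m) with hκ'
  -- letters
  set ρ := ofRatClassBaseChangeEquiv hX 1 with hρ
  set v : Module.Basis _ ℂ (complexBetti A.X 1) := cbσ.map ρ with hv
  set eL : Module.Basis _ ℂ (complexBetti A.X 1) := eC.map ρ with heL
  have heLQ : ∀ i, IsRationalClass (eL i) := fun i => by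
    rw [heL, Module.Basis.map_apply, heC, Algebra.TensorProduct.basis_apply, hρ,
      ofRatClassBaseChangeEquiv_apply, ofRatClassBaseChange_tmul, one_smul]
    exact isRationalClass_ofRatClass _
  have hv_apply : ∀ m, v m = ofRatClassBaseChange (Motives.ComplexPoints A.X) 1 (cb (φι m)) := fun m => by
    rw [hv, Module.Basis.map_apply, hcbσ, hρ, ofRatClassBaseChangeEquiv_apply]
  have hv0 : ∀ m, κ' m = 0 → IsOfHodgeType A.dim A.X 1 1 0 (v m) := by
    intro m hm
    rw [hv_apply, ← BettiUniverse.mem_hodge_piece_iff hHD hI hX (k := 1) (p := 1) (q := 0) rfl]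
    exact (hkind (φι m)).1 hm
  have hv1 : ∀ m, κ' m = 1 → IsOfHodgeType A.dim A.X 1 0 1 (v m) := by
    intro m hm
    rw [hv_apply, ← BettiUniverse.mem_hodge_piece_iff hHD hI hX (k := 1) (p := 0) (q := 1) rfl]
    exact (hkind (φι m)).2 hm
  -- (α) an antisymmetric kind-balanced coefficient function in the adapted letters
  obtain ⟨ax, hax_bal, hax_anti, hcax⟩ := hg.exists_antisymm_kindBalanced_wordEval_eq v κ' hv0 hv1 hp hc
  -- the change of letters to the rational letters
  set G : Matrix _ _ ℂ := eC.toMatrix cbσ with hG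
  set G' : Matrix _ _ ℂ := cbσ.toMatrix eC with hG'
  have hG'G : G' * G = 1 := cbσ.toMatrix_mul_toMatrix_flip eC
  have hve : ∀ m, v m = ∑ i, G i m • eL i := fun m => by
    simp only [hv, heL, Module.Basis.map_apply, ← map_smul, ← map_sum]
    congr 1
    exact (eC.sum_toMatrix_smul_self (v := ⇑cbσ) (j := m)).symm
  have hletters : ∀ j m, avLetters g v (j, m) = ∑ i, G i m • avLetters g eL (j, i) :=
    avLetters_baseChange g G hve
  set aE := colourChangeAt (fun _ : Fin n => G) ax with haE
  have haE_anti : IsAntisymm aE := hax_anti.colourChangeAt _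
  have hcaE : wordEval F (avLetters g eL) aE = c := by
    rw [haE, ← wordEval_eq_wordEval_colourChangeAt F (fun _ : Fin n => G) hletters ax, hcax]
  -- rationality of `aE`
  obtain ⟨q, hq⟩ := hg.exists_rat_wordEval_eq eL heLQ hcQ
  obtain ⟨q', -, haEq⟩ := haE_anti.exists_eq_algebraMap_of_wordEval_eq hFinj (hg.letterBasis eL)
    (q := q) (by rw [AVSlots.coe_letterBasis, hcaE, hFdef, hq])
  have hslice_e : ∀ u, wordSlice aE u = wordRepAt ℂ (fun _ : Fin (2 * p) => G) (wordSlice ax u) :=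
    fun u => wordSlice_colourChangeAt (fun _ : Fin n => G) ax u
  -- the Hodge operator `Θ`: `diag(±1)` in the adapted letters
  obtain ⟨Θ, hΘ⟩ := exists_hodgeTheta (BettiUniverse.hodge hHD (AbelianVariety.isSmoothProjective_holds (A := A)) 1)
  obtain ⟨-, -, hΘ10, hΘ01, -⟩ :=
    UnitaryTheta.theta_facts (BettiUniverse.hodge hHD (AbelianVariety.isSmoothProjective_holds (A := A)) 1)
      hn1 heff hΘ
  have hΘb : ∀ m, Θ (cbσ m) = (if κ' m = 0 then (1 : ℂ) else -1) • cbσ m := by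
    intro m
    rw [hcbσ]
    rcases fin2_cases' (κ' m) with h0 | h1'
    · rw [h0, if_pos rfl, one_smul]
      exact hΘ10 _ ((hkind (φι m)).1 h0)
    · rw [h1', if_neg one_ne_zero, neg_one_smul]
      exact hΘ01 _ ((hkind (φι m)).2 h1')
  have hΘcb : LinearMap.toMatrix cbσ cbσ Θ = kindDiag κ' := by
    ext i m
    rw [LinearMap.toMatrix_apply, hΘb, map_smul, Module.Basis.repr_self, Finsupp.smul_apply,
      Finsupp.single_apply, kindDiag, Matrix.diagonal_apply, smul_eq_mul, mul_ite, mul_one, mul_zero]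
    by_cases him : i = m
    · subst him; rw [if_pos rfl]
    · rw [if_neg (Ne.symm him), if_neg him]
  have hJG : LinearMap.toMatrix eC eC Θ * G = G * kindDiag κ' := by
    rw [← hΘcb, hG, linearMap_toMatrix_mul_basis_toMatrix, basis_toMatrix_mul_linearMap_toMatrix]
  have hΘq : ∀ u : Fin (2 * p) → Fin n, wordDerAt ℂ (fun _ : Fin (2 * p) => LinearMap.toMatrix eC eC Θ)
      (wordSlice (fun w => algebraMap ℚ ℂ (q' w)) u) = 0 := by
    intro u
    rw [← haEq, hslice_e]
    refine wordDerAt_wordRepAt_eq_zero_of_mul_eq ℂ (fun _ : Fin (2 * p) => G) (fun _ => hJG) ?_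
    rw [wordDerAt_const]
    exact wordDer_kindDiag_wordSlice_eq_zero κ' hax_bal u
  -- structure of the adapted basis for `ψ_ℂ` and `φ_ℂ`
  set ψC := ψ.form.baseChange ℂ with hψC
  have hφskewC : ∀ x y, ψC (φ.baseChange ℂ x) y + ψC x (φ.baseChange ℂ y) = 0 := by
    haveI : Nontrivial (bettiCohomology A.X 1) := by
      by_contra hV
      rw [not_nontrivial_iff_subsingleton] at hV
      haveI : Subsingleton (ℂ ⊗[ℚ] bettiCohomology A.X 1) := by
        refine ⟨fun x y => ?_⟩
        have h : ∀ z : ℂ ⊗[ℚ] bettiCohomology A.X 1, z = 0 := fun z => by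
          induction z using TensorProduct.induction_on with
          | zero => rfl
          | tmul c' v' => rw [Subsingleton.elim v' 0, TensorProduct.tmul_zero]
          | add a' b' ha hb => rw [ha, hb, add_zero]
        rw [h x, h y]
      have h0 : Module.finrank ℂ ↥(Module.End.eigenspace (φ.baseChange ℂ) μ ⊓
          (BettiUniverse.hodge hHD (AbelianVariety.isSmoothProjective_holds (A := A)) 1).piece 0 1) = 0 :=
        Module.finrank_zero_of_subsingleton
      omega
    exact ThetaSubalgebra.formBaseChange_add_eq_zero_of_skew ψ
      (UnitaryTheta.form_apply_add_form_apply_eq_zero _ ψ hφE hd hφ2 hE)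
  have hiso0 : ∀ i j, ψC (cb (0, i)) (cb (0, j)) = 0 := fun i j =>
    UnitaryTheta.form_eq_zero_of_mem_eigenspace hφskewC hμ0 (hcbW i) (hcbW j)
  have hiso1 : ∀ i j, ψC (cb (1, i)) (cb (1, j)) = 0 := fun i j =>
    UnitaryTheta.form_eq_zero_of_mem_eigenspace hφskewC (neg_ne_zero.2 hμ0) (hcbW' i) (hcbW' j)
  have hswap10 : ∀ i j, ψC (cb (1, i)) (cb (0, j)) = -(if j = i then 1 else 0) := fun i j => by
    rw [hψC, ψ.form_baseChange_swap, show (((1 : ℕ) : ℤ)).negOnePow = -1 from Int.negOnePow_one, ← hψC, hdual]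
    split_ifs <;> simp
  have hφcb : ∀ t ℓ, φ.baseChange ℂ (cb (t, ℓ)) = (if t = 0 then μ else -μ) • cb (t, ℓ) := by
    intro t ℓ
    rcases fin2_cases' t with rfl | rfl
    · rw [if_pos rfl]; exact Module.End.mem_eigenspace_iff.1 (hcbW ℓ)
    · rw [if_neg one_ne_zero]; exact Module.End.mem_eigenspace_iff.1 (hcbW' ℓ)
  -- the invariance of every slice under the typed differentials, via THEOREM L′
  have key : ∀ (X : Matrix (Fin n₀) (Fin n₀) ℂ) (u : Fin (2 * p) → Fin n),
      wordDerAt ℂ (fun _ : Fin (2 * p) => blockLiftGen φι (fun t : Fin 2 => if t = 0 then X else -Xᵀ))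
        (wordSlice ax u) = 0 := by
    intro X u
    set Nf : Fin 2 → Matrix (Fin n₀) (Fin n₀) ℂ := fun t => if t = 0 then X else -Xᵀ with hNf
    have hNf0 : Nf 0 = X := if_pos rfl
    have hNf1 : Nf 1 = -Xᵀ := if_neg one_ne_zero
    set Y := Matrix.toLin cbσ cbσ (blockLiftGen φι Nf) with hYdef
    have hYcb : ∀ t ℓ, Y (cb (t, ℓ)) = ∑ r, Nf t r ℓ • cb (t, r) :=
      fun t ℓ => toLin_blockLiftGen_apply φι cbσ (⇑cb) hcbσ Nf t ℓ
    have hYφ : Y * φ.baseChange ℂ = φ.baseChange ℂ * Y := by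
      refine cb.ext fun tl => ?_
      obtain ⟨t, ℓ⟩ := tl
      rw [Module.End.mul_apply, Module.End.mul_apply, hφcb, map_smul, hYcb, map_sum, Finset.smul_sum]
      exact Finset.sum_congr rfl fun r _ => by rw [map_smul, hφcb, smul_comm]
    have hYskew : ∀ x y, ψC (Y x) y + ψC x (Y y) = 0 := by
      have hB : ψC ∘ₗ Y + ψC.compl₂ Y = 0 := by
        refine LinearMap.BilinForm.ext_basis cb fun tk tl => ?_
        obtain ⟨t, k⟩ := tk
        obtain ⟨t', ℓ⟩ := tl
        rw [LinearMap.add_apply, LinearMap.add_apply, LinearMap.comp_apply, LinearMap.compl₂_apply,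
          LinearMap.zero_apply, LinearMap.zero_apply, hYcb, hYcb, map_sum, LinearMap.sum_apply, map_sum]
        simp only [map_smul, LinearMap.smul_apply, smul_eq_mul]
        rcases fin2_cases' t with rfl | rfl <;> rcases fin2_cases' t' with rfl | rfl
        · simp [hiso0]
        · simp [hNf0, hNf1, hdual, Matrix.neg_apply, Matrix.transpose_apply, mul_ite, Finset.sum_ite_eq,
            Finset.sum_ite_eq']
        · simp [hNf0, hNf1, hswap10, Matrix.neg_apply, Matrix.transpose_apply, mul_ite, Finset.sum_ite_eq,
            Finset.sum_ite_eq']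
        · simp [hiso1]
      intro x y
      have h := LinearMap.congr_fun (LinearMap.congr_fun hB x) y
      simpa only [LinearMap.add_apply, LinearMap.comp_apply, LinearMap.compl₂_apply, LinearMap.zero_apply]
        using h
    have hL := UnitaryTheta.wordDerAt_eq_zero_of_commute_of_skew
      (BettiUniverse.hodge hHD (AbelianVariety.isSmoothProjective_holds (A := A)) 1) hn1 heff ψ hφE hd hφ2 hE
      hμ h1 h2 eQ q' hΘ hΘq hYφ hYskew u
    rw [← haEq, hslice_e] at hL
    have hYG : ∀ _t : Fin (2 * p), LinearMap.toMatrix eC eC Y * G = G * LinearMap.toMatrix cbσ cbσ Y :=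
      fun _ => by rw [hG, linearMap_toMatrix_mul_basis_toMatrix, basis_toMatrix_mul_linearMap_toMatrix]
    have hblk : LinearMap.toMatrix cbσ cbσ Y = blockLiftGen φι Nf := by
      rw [hYdef, LinearMap.toMatrix_toLin]
    have h3 : wordRepAt ℂ (fun _ : Fin (2 * p) => G)
        (wordDerAt ℂ (fun _ : Fin (2 * p) => blockLiftGen φι Nf) (wordSlice ax u)) = 0 := by
      rw [← hblk, wordRepAt_wordDerAt_of_mul_eq ℂ (fun _ : Fin (2 * p) => G) hYG, hL]
    exact wordRepAt_injective ℂ (g := fun _ : Fin (2 * p) => G) (g' := fun _ : Fin (2 * p) => G')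
      (funext fun _ => hG'G) (by rw [h3, map_zero])
  -- the coefficient function, refined to slot-and-type colours
  refine ⟨placeRefineGen φι ax, ?_, fun U X => ?_⟩
  · rw [← hcax]
    have hx : (fun x : (Fin n × Fin 2) × Fin n₀ => avLetters g v (x.1.1, φι.symm (x.1.2, x.2))) =
        fun x => avLetters g (fun tl : Fin 2 × Fin n₀ =>
          ofRatClassBaseChange (Motives.ComplexPoints A.X) 1 (cb tl)) (x.1.1, (x.1.2, x.2)) := by
      funext x
      rw [avLetters_apply, avLetters_apply, hv_apply, Equiv.apply_symm_apply]
    rw [← hx]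
    exact wordEval_placeRefineGen F φι (avLetters g v) ax
  · exact wordDerAt_placeRefineGen_eq_zero φι (fun t : Fin 2 => if t = 0 then X else -Xᵀ) (key X) U

end Invariance

/-! ### §4 The assembly: `Bᵖ(B) ⊆ Dᵖ(B) ⊗ ℂ` by the unipotent bridge, the tensor FFT for `GL(W)` and the crossed classes -/

section Assembly

variable {A B : AbelianVariety ℂ} {n : ℕ} {g : Fin n → (B ⟶ A)}

open scoped Classical in
/-- **`Bᵖ(B) ⊆ Dᵖ(B) ⊗ ℂ` for an abelian variety `B` with slots over `A` of unitary type `(m, 1)`** (data as in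
`exists_unitaryInvariant_coeff`), granted that the CROSSED CLASSES `∑_ℓ g_j^* e_ℓ ⌣ g_{j'}^* f_ℓ` of two slots lie
in `B¹(B) ⊗ ℂ` (`hcross`; Milne Prop. 3.3: the degree-2 invariants of `GL(W)` on `W ⊕ W^∨` are the pairing).
Every rational `(p,p)`-class on `B` is a `ℂ`-combination of products of `p` rational `(1,1)`-classes: the
slices of its coefficient function are killed by `𝔤𝔩(W)` (`exists_unitaryInvariant_coeff`), hence fixed by
`GL(W)` (`ClassicalInvariants.wordRepAt_mixedFamily_eq_self_of_forall_wordDerAt_eq_zero`, Goodman–Wallach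
Thm. 2.2.2), hence combinations of complete contractions (tensor FFT for `GL`, Goodman–Wallach Thm. 5.3.1,
`mem_span_contractionTensor_of_forall_wordDerAt_mixedLieFamily_eq_zero`), each of which evaluates on the letters
to `±` a product of crossed classes (`Milne1999.sum_contractionTensor_smul_eq`, `sum_cupPowOne_glPairWord_mem`:
Milne Prop. 3.6 (c) "each of which is visibly a product of 2-forms"). Gordon 6.3.3: "then `Hg(A) = Lf(A)` and
thus `Hdg(Aⁿ) = Div(Aⁿ)`". [cite: Ribet1983, Thm. 0 and Thm. 3] [cite: Gordon1997, Thm. 6.3 (3) and §6 (pp. 18–19)]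
[cite: Milne1999LefschetzClasses, Prop. 3.6 (c) and Remark 3.7 (pp. 655–656)] [cite: GoodmanWallachGTM255, Thm. 2.2.2 and Thm. 5.3.1] -/
theorem AVSlots.unitaryHodgeClasses_divisorial [HodgeTensorFacts.{0, 0}] (hg : AVSlots A B g)
    (hHD : exists_isReal_hodgeModel) (hI : hodgePQ_independent_of_hodgeModel)
    (ψ : (BettiUniverse.hodge hHD (AbelianVariety.isSmoothProjective_holds (A := A)) 1).Polarization)
    {φ : Module.End ℚ (bettiCohomology A.X 1)}
    (hφE : φ ∈ (BettiUniverse.hodge hHD (AbelianVariety.isSmoothProjective_holds (A := A)) 1).endAlg)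
    {d : ℚ} (hd : 0 < d) (hφ2 : φ * φ = -(d • 1))
    (hE : ∀ a ∈ (BettiUniverse.hodge hHD (AbelianVariety.isSmoothProjective_holds (A := A)) 1).endAlg,
      ∃ x y : ℚ, a = x • 1 + y • φ)
    {μ : ℂ} (hμ : μ ^ 2 = -(d : ℂ))
    (h1 : Module.finrank ℂ ↥(Module.End.eigenspace (φ.baseChange ℂ) μ ⊓
      (BettiUniverse.hodge hHD (AbelianVariety.isSmoothProjective_holds (A := A)) 1).piece 0 1) = 1)
    (h2 : 2 ≤ Module.finrank ℂ ↥(Module.End.eigenspace (φ.baseChange ℂ) μ ⊓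
      (BettiUniverse.hodge hHD (AbelianVariety.isSmoothProjective_holds (A := A)) 1).piece 1 0))
    {n₀ : ℕ} (cb : Module.Basis (Fin 2 × Fin n₀) ℂ (ℂ ⊗[ℚ] bettiCohomology A.X 1)) (κ : Fin n₀ → Fin 2)
    (hcbW : ∀ ℓ, cb (0, ℓ) ∈ Module.End.eigenspace (φ.baseChange ℂ) μ)
    (hcbW' : ∀ ℓ, cb (1, ℓ) ∈ Module.End.eigenspace (φ.baseChange ℂ) (-μ))
    (hcb0 : ∀ ℓ, κ ℓ = 0 →
      cb (0, ℓ) ∈ (BettiUniverse.hodge hHD (AbelianVariety.isSmoothProjective_holds (A := A)) 1).piece 1 0 ∧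
      cb (1, ℓ) ∈ (BettiUniverse.hodge hHD (AbelianVariety.isSmoothProjective_holds (A := A)) 1).piece 0 1)
    (hcb1 : ∀ ℓ, κ ℓ = 1 →
      cb (0, ℓ) ∈ (BettiUniverse.hodge hHD (AbelianVariety.isSmoothProjective_holds (A := A)) 1).piece 0 1 ∧
      cb (1, ℓ) ∈ (BettiUniverse.hodge hHD (AbelianVariety.isSmoothProjective_holds (A := A)) 1).piece 1 0)
    (hdual : ∀ i j, ψ.form.baseChange ℂ (cb (0, i)) (cb (1, j)) = if i = j then 1 else 0)
    (hcross : ∀ j j' : Fin n, (∑ ℓ : Fin n₀, cupProduct (rfl : 1 + 1 = 2)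
        (avLetters g (fun tl : Fin 2 × Fin n₀ =>
          ofRatClassBaseChange (Motives.ComplexPoints A.X) 1 (cb tl)) (j, ((0 : Fin 2), ℓ)))
        (avLetters g (fun tl : Fin 2 × Fin n₀ =>
          ofRatClassBaseChange (Motives.ComplexPoints A.X) 1 (cb tl)) (j', ((1 : Fin 2), ℓ)))) ∈
      Submodule.span ℂ {c : complexBetti B.X 2 | IsRationalClass c ∧ IsOfHodgeType B.dim B.X 2 1 1 c})
    (p : ℕ) (c : complexBetti B.X (2 * p)) (hcQ : IsRationalClass c)
    (hc : IsOfHodgeType B.dim B.X (2 * p) p p c) :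
    c ∈ divisorClassesSpan B.X B.dim p := by
  classical
  rcases Nat.eq_zero_or_pos p with rfl | hp
  · exact AbelianVariety.mem_divisorClassesSpan_zero B c
  obtain ⟨a, hca, hkill⟩ := hg.exists_unitaryInvariant_coeff hHD hI ψ hφE hd hφ2 hE hμ h1 h2 cb κ hcbW hcbW'
    hcb0 hcb1 hdual hp hcQ hc
  set y : (Fin n × Fin 2) × Fin n₀ → complexBetti B.X 1 := fun x => avLetters g (fun tl : Fin 2 × Fin n₀ =>
    ofRatClassBaseChange (Motives.ComplexPoints A.X) 1 (cb tl)) (x.1.1, (x.1.2, x.2)) with hy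
  set F := cupPowOneAlt ℂ (Motives.ComplexPoints B.X) (2 * p) with hF
  rw [← hca, wordEval_eq_sum_wordSlice]
  refine Submodule.sum_mem _ fun U _ => ?_
  -- Lie invariance ⟹ `GL(W)`-invariance ⟹ a combination of complete contractions (tensor FFT for `GL`)
  set ty : Fin (2 * p) → Bool := fun t => decide ((U t).2 = 0) with hty
  have hLie : ∀ X : Matrix (Fin n₀) (Fin n₀) ℂ, wordDerAt ℂ (mixedLieFamily ty X) (wordSlice a U) = 0 := by
    intro X
    have hfam : mixedLieFamily ty X = fun t => if (U t).2 = 0 then X else -Xᵀ := by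
      funext t
      simp only [mixedLieFamily, hty, decide_eq_true_eq]
    rw [hfam]
    exact hkill U X
  have hmem := mem_span_contractionTensor_of_forall_wordDerAt_mixedLieFamily_eq_zero ty hLie
  set Λ := Fintype.linearCombination ℂ (fun ε : Word n₀ (2 * p) => F (fun q => y (U q, ε q))) with hΛ
  have hΛapply : ∀ cf : Word n₀ (2 * p) → ℂ, Λ cf = ∑ ε, cf ε • F (fun q => y (U q, ε q)) :=
    fun cf => Fintype.linearCombination_apply ℂ _ cf
  rw [← hΛapply]
  refine (Submodule.span_le (p := (divisorClassesSpan B.X B.dim p).comap Λ)).2 ?_ hmem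
  rintro _ ⟨β, -, rfl⟩
  rw [SetLike.mem_coe, Submodule.mem_comap, hΛapply]
  -- evaluation of a complete contraction: `±` a product of crossed classes
  obtain ⟨π, eP, hsum⟩ := Milne1999.sum_contractionTensor_smul_eq F ty β y U
  rw [hsum]
  refine Submodule.smul_mem _ _ ?_
  simp_rw [hF, cupPowOneAlt_apply]
  refine Milne1999.sum_cupPowOne_glPairWord_mem y p _ _ fun i => ?_
  have h0 : (U (eP.symm i : Fin (2 * p))).2 = 0 := by
    have h := (eP.symm i).2
    simpa [hty] using h
  have h1' : (U (β (eP.symm i) : Fin (2 * p))).2 = 1 := by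
    have h := (β (eP.symm i)).2
    simp only [hty, decide_eq_false_iff_not] at h
    rcases Fin.eq_zero_or_eq_succ (U (β (eP.symm i) : Fin (2 * p))).2 with h' | ⟨j, hj⟩
    · exact absurd h' h
    · rw [hj, Fin.eq_zero j]; rfl
  have hyU : ∀ (q : Fin (2 * p)) (ℓ : Fin n₀), y (U q, ℓ) = avLetters g (fun tl : Fin 2 × Fin n₀ =>
      ofRatClassBaseChange (Motives.ComplexPoints A.X) 1 (cb tl)) ((U q).1, ((U q).2, ℓ)) := fun q ℓ => rfl
  simp only [hyU, h0, h1']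
  exact hcross _ _

/-- **`IsDivisorGenerated B`** (the tree's spelling of `B•(B) = D•(B) ⊗ ℂ`) for every abelian variety `B` with
slots over an abelian variety `A` carrying the unitary data of type `(m, 1)` and crossed classes in
`B¹ ⊗ ℂ`. [cite: Ribet1983, Thm. 0 and Thm. 3] [cite: Gordon1997, Thm. 6.3 (3)] -/
theorem AVSlots.isDivisorGenerated_of_unitaryData [HodgeTensorFacts.{0, 0}] (hg : AVSlots A B g)
    (hHD : exists_isReal_hodgeModel) (hI : hodgePQ_independent_of_hodgeModel)
    (ψ : (BettiUniverse.hodge hHD (AbelianVariety.isSmoothProjective_holds (A := A)) 1).Polarization)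
    {φ : Module.End ℚ (bettiCohomology A.X 1)}
    (hφE : φ ∈ (BettiUniverse.hodge hHD (AbelianVariety.isSmoothProjective_holds (A := A)) 1).endAlg)
    {d : ℚ} (hd : 0 < d) (hφ2 : φ * φ = -(d • 1))
    (hE : ∀ a ∈ (BettiUniverse.hodge hHD (AbelianVariety.isSmoothProjective_holds (A := A)) 1).endAlg,
      ∃ x y : ℚ, a = x • 1 + y • φ)
    {μ : ℂ} (hμ : μ ^ 2 = -(d : ℂ))
    (h1 : Module.finrank ℂ ↥(Module.End.eigenspace (φ.baseChange ℂ) μ ⊓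
      (BettiUniverse.hodge hHD (AbelianVariety.isSmoothProjective_holds (A := A)) 1).piece 0 1) = 1)
    (h2 : 2 ≤ Module.finrank ℂ ↥(Module.End.eigenspace (φ.baseChange ℂ) μ ⊓
      (BettiUniverse.hodge hHD (AbelianVariety.isSmoothProjective_holds (A := A)) 1).piece 1 0))
    {n₀ : ℕ} (cb : Module.Basis (Fin 2 × Fin n₀) ℂ (ℂ ⊗[ℚ] bettiCohomology A.X 1)) (κ : Fin n₀ → Fin 2)
    (hcbW : ∀ ℓ, cb (0, ℓ) ∈ Module.End.eigenspace (φ.baseChange ℂ) μ)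
    (hcbW' : ∀ ℓ, cb (1, ℓ) ∈ Module.End.eigenspace (φ.baseChange ℂ) (-μ))
    (hcb0 : ∀ ℓ, κ ℓ = 0 →
      cb (0, ℓ) ∈ (BettiUniverse.hodge hHD (AbelianVariety.isSmoothProjective_holds (A := A)) 1).piece 1 0 ∧
      cb (1, ℓ) ∈ (BettiUniverse.hodge hHD (AbelianVariety.isSmoothProjective_holds (A := A)) 1).piece 0 1)
    (hcb1 : ∀ ℓ, κ ℓ = 1 →
      cb (0, ℓ) ∈ (BettiUniverse.hodge hHD (AbelianVariety.isSmoothProjective_holds (A := A)) 1).piece 0 1 ∧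
      cb (1, ℓ) ∈ (BettiUniverse.hodge hHD (AbelianVariety.isSmoothProjective_holds (A := A)) 1).piece 1 0)
    (hdual : ∀ i j, ψ.form.baseChange ℂ (cb (0, i)) (cb (1, j)) = if i = j then 1 else 0)
    (hcross : ∀ j j' : Fin n, (∑ ℓ : Fin n₀, cupProduct (rfl : 1 + 1 = 2)
        (avLetters g (fun tl : Fin 2 × Fin n₀ =>
          ofRatClassBaseChange (Motives.ComplexPoints A.X) 1 (cb tl)) (j, ((0 : Fin 2), ℓ)))
        (avLetters g (fun tl : Fin 2 × Fin n₀ =>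
          ofRatClassBaseChange (Motives.ComplexPoints A.X) 1 (cb tl)) (j', ((1 : Fin 2), ℓ)))) ∈
      Submodule.span ℂ {c : complexBetti B.X 2 | IsRationalClass c ∧ IsOfHodgeType B.dim B.X 2 1 1 c}) :
    IsDivisorGenerated B :=
  fun p c hcQ hc => hg.unitaryHodgeClasses_divisorial hHD hI ψ hφE hd hφ2 hE hμ h1 h2 cb κ hcbW hcbW' hcb0 hcb1
    hdual hcross p c hcQ hc

end Assembly

end Literature.AlgebraicGeometry.HodgeTheory

end
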